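import Summits.CriticalPhenomena.SAWScalingLimit.Theses.SAWRestrictionRigidity
import Summits.CriticalPhenomena.SAWScalingLimit.Theorems.SubseqIdentification.Negative.Necessity
import Summits.CriticalPhenomena.SAWScalingLimit.Theorems.SubseqIdentification.Negative.ProbabilityRedundant
import Literature.Probability.RandomPlanarGeometry.SLEConvergenceCriterion
import Literature.Probability.RandomPlanarGeometry.SAWScalingLimitFamily
import Summits.CriticalPhenomena.SAWScalingLimit.Theorems.SAWRestrictionRigidityLimitExistsStubInterleave
import Summits.CriticalPhenomena.SAWScalingLimit.Theorems.SAWRestrictionRigidityLimitExistsStubPortmanteau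
import Summits.CriticalPhenomena.SAWScalingLimit.Theorems.SAWRestrictionRigidityLimitExistsStubAvoidanceSandwich
import Summits.CriticalPhenomena.SAWScalingLimit.Theorems.SAWRestrictionRigidityLimitExistsTightNecessity
import Summits.CriticalPhenomena.SAWScalingLimit.Theorems.SAWRestrictionRigidityLimitExistsCarrierNecessity
import Summits.CriticalPhenomena.SAWScalingLimit.Theorems.SAWRestrictionRigidityLimitExistsCocycleNecessity
import Summits.CriticalPhenomena.SAWScalingLimit.Theorems.SAWRestrictionRigidityLimitExistsPointwise
import Summits.CriticalPhenomena.SAWScalingLimit.Theorems.SAWRestrictionRigidityLimitExistsObservablewiseTight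
import Summits.CriticalPhenomena.SAWScalingLimit.Theorems.SAWRestrictionRigidityLimitExistsCountable
import Summits.CriticalPhenomena.SAWScalingLimit.Theorems.SAWRestrictionRigidityLimitExistsLeaves
import Summits.CriticalPhenomena.SAWScalingLimit.Theorems.SAWWeldingIdentificationEventualTightSplit
import HarnessLib.Audit

/-!
# Crux `LimitExists` (stmt-CriticalPhenomena-1371) — line `registered` (`Lines/birth.lean`), skeleton v7

Lead c5 (prover-line-stmt-CriticalPhenomena-1371-c5-0, 2026-08-17): v7 = v6 UNCHANGED in its composition and stubs
(sorries = exactly the three EXISTING open items (T) stmt-1372, (S) stmt-4982, (C) stmt-1369; skeleton recovered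
byte-identical from the tree and re-registered from this seat's live folder), plus the leaf census refreshed to the
CURRENT split of (T) (§ "Bounded leaf census" at the end of this file): since v6 the tightness chain of stmt-1372 was
re-split (welding split, glue `eventualTight_of_virginArcTraversalTightBounded_of_confinementPositivity`, p151500) so
that consumers need only the BOUNDED-EXTERIOR atom `VirginArcTraversalTightBounded` (stmt-18042) instead of the
all-exteriors atom `VirginArcTraversalTight` (stmt-17940 ⟹ stmt-18042, `VirginArcTraversalTightBounded_of_item`):
* `crux_of_leaves_bounded : VirginArcTraversalTightBounded (stmt-18042) → ConfinementPositivity (stmt-17587) →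
  SequentialSlitAvoidance (residual of stmt-4982) → AvoidanceLimit (stmt-10649) → ∃ P, SAW.IsScalingLimitFamily P`
  (tree twin `limitExists_of_leaves_bounded`, registered stub, p158457) — STRONGER than v6's `crux_of_leaves`;
* `stub_eventualTight_of_leaves_bounded` — which bounded leaf feeds (T) (`EventualTightSWI_of_items`).
Poll of the leaves at 2026-08-17T11:45Z (nothing closed since v6): stmt-1372 lead c9 (skeleton v9, open X2c1b =
stmt-18042 + E = stmt-17587), stmt-17587 lead c1 (skeleton v2, 4 stubs open), stmt-4982 lead c9 (6/7 landed, residual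
`stub_seqSlitAvoidance`), stmt-10649 lead c6 (3 stubs open; strategist s1: no strategy short of summit), stmt-1369
unclaimed (⟸ stmt-10649, p145541).  wave: none — the three open stubs are verbatim staffed items.

Lead c4 (prover-line-stmt-CriticalPhenomena-1371-c4-0, 2026-08-17): v6 = v5 UNCHANGED in its composition and stubs
(sorries = exactly the three EXISTING open items (T) stmt-1372, (S) stmt-4982, (C) stmt-1369), plus two landed
additions pinned at the end of this file (§ "Countable form and leaf census"):
* COUNTABLE FORM modulo (T) (p156447, `Theorems/SAWRestrictionRigidityLimitExistsCountable`):
  `exists_countable_separating_integral` (a countable separating family of bounded continuous observables on any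
  second-countable metric Borel space — closed π-system of complements of finite unions of basic opens, Mathlib's
  `IsClosed.apprSeq`, `ext_of_generate_finite`), `limitExists_iff_eventualTight_and_forall_mem_tendsto_integral`
  (for ANY separating class `F`: `LimitExists ↔ EventualTight ∧ ∀ D a b approx, ∀ f ∈ F, ∃ L, E_δ[f(curve)] → L`) and
  `limitExists_iff_eventualTight_and_countable` (ONE countable separating `F` for which this holds).  So beyond
  (T) the crux is the convergence of COUNTABLY many real sequences per (domain, approximation) — the exact split
  into a compactness half (T) and a countable numerical half (c3: no countable family can force (T)).
* LEAF CENSUS (p156523, `Theorems/SAWRestrictionRigidityLimitExistsLeaves`): `limitExists_of_leaves :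
  VirginArcTraversalTight (stmt-17940) → ConfinementPositivity (stmt-17587) → SequentialSlitAvoidance (residual of
  stmt-4982, lead c9) → AvoidanceLimit (stmt-10649) → LimitExists`, composing the other chains' landed reductions
  (`EventualTight_of_items`, `line_slitContinuousRestriction` p154999, `avoidanceCocycleLimit_of_avoidanceLimit`
  p145541) into `LimitExists_of_items` (p145872): the existence half of the SAW scaling limit, shared by eight
  routes, hinges on exactly these four lattice statements (all staffed under their own chains, 2026-08-17T11Z).

Lead c3 (prover-line-stmt-CriticalPhenomena-1371-c3-0, 2026-08-17): v5 = v4 UNCHANGED in its composition and stubs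
(sorries = exactly the three EXISTING open items (T) stmt-1372, (S) stmt-4982, (C) stmt-1369), plus the crux in its BAREST
forms, landed as Theorems / Literature and pinned at the end of this file (§ "Barest forms of the crux"):
* POINTWISE: `limitExists_iff_forall_exists_tendstoLaw : LimitExists ↔ ∀ D a b, IsEndpointApprox D a b → ∃ ν, TendstoLaw
  curve law id ν` (p152133, `Theorems/SAWRestrictionRigidityLimitExistsPointwise`) — the `∃ P ∀ D` commutation, the
  consistency across endpoint approximations (interleaving), probability and chordality of the limit are FREE;
* OBSERVABLE-WISE modulo (T): `limitExists_iff_eventualTight_and_forall_tendsto_integral` (p152394,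
  `…LimitExistsObservablewise`);
* OBSERVABLE-WISE, UNCONDITIONAL: `limitExists_iff_forall_tendsto_integral : LimitExists ↔ ∀ D a b, IsEndpointApprox D a b →
  ∀ f : CurveClass ℂ →ᵇ ℝ, ∃ L : ℝ, Tendsto (fun δ => ∫ γ, f γ.curve ∂law) (𝓝[>] 0) (𝓝 L)` and
  `eventualTight_of_forall_tendsto_integral` (observable-wise convergence ⇒ (T)) (p154556,
  `…LimitExistsObservablewiseTight`), resting on the WEAK SEQUENTIAL COMPLETENESS of `P(X)`, `X` Polish
  (Alexandroff–Varadarajan; Bogachev MT II §8.7; new Literature `MeasureTheory/Radon/WeakSequentialCompleteness{Humps,Tight,}`,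
  p153438/p154161/p154301: the gliding hump — observable-wise convergent probability measures are tight and converge weakly
  to a probability measure).
So the crux carries NO hidden measure-theoretic content: it is EXACTLY "every bounded continuous observable of the rescaled
critical SAW has a real scaling limit, for every Dobrushin domain and every endpoint approximation"; the uncountable
supremum over observables is where tightness (T) hides (no countable family can force it).

Lead c2 (prover-line-stmt-CriticalPhenomena-1371-c2-0, 2026-08-17): v4 = v3 (lead c1) UNCHANGED in its
composition and stubs (sorries = exactly the three EXISTING open items (T) stmt-1372, (S) stmt-4982,
(C) stmt-1369), plus a LOSS ANALYSIS of the three open stubs, landed as Theorems and imported (§ "Loss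
analysis" at the end of this file):
* (T) is implied by the crux: `eventualTight_of_limitExists : LimitExists → EventualTight`
  (p148374, `Theorems/SAWRestrictionRigidityLimitExistsTightNecessity`) — the reduction loses nothing at (T);
* (S) modulo the crux IS the item `SAWConfRestriction.SimpleOfLimit` (stmt-0774):
  `simpleSubseqLimits_of_limitExists_of_simpleOfLimit`, `simpleOfLimit_of_simpleSubseqLimits`
  (p148840, `…CarrierNecessity`);
* (C) modulo the crux (with witness `P`) IS a regularity property of the limit — no mass on the chords in
  `cl D'` touching `cl (cl D ∖ cl D')`: `avoidanceCocycleLimit_of_limit_nullTouching` (p148757,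
  `…CocycleNecessity`); and (C) is implied by the sub-problem statement:
  `avoidanceCocycleLimit_of_sawScalingLimit : SAWScalingLimit → AvoidanceCocycleLimit` (p149105,
  `…CocycleOfScalingLimit`, composing the tree's `avoidanceLimit_of_sawScalingLimit` with the bridge p145541).
So every input of the line is summit-implied ((S) via the tree's `pastFuture_of_sawScalingLimit` /
`crux_iff_pastFuture`), and a refutation of any stub refutes the conjunct `SAWScalingLimit` as typed.

Lead c1 (prover-line-stmt-CriticalPhenomena-1371-c1-0, 2026-08-17), reshaping the planner's birth
skeleton (v1, planner-skel-stmt-CriticalPhenomena-1371-0).  v3 = v2 with the three provable glue stubs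
LANDED and imported (wave 1): `stub_interleave` (p143650, `Theorems/SAWRestrictionRigidityLimitExistsStubInterleave`),
`stub_portmanteau` (p144427, `…StubPortmanteau`), `stub_avoidanceSandwich` (p144652, `…StubAvoidanceSandwich`);
remaining sorries = exactly the three EXISTING open lattice items (T) stmt-1372, (S) stmt-4982, (C) stmt-1369.

Route `SAWRestrictionRigidity` (shared verbatim by SAWGaussianRotation, SAWInfinitesimalRigidity,
SAWPoissonBanks, SAWExpCovariance, SAWConePseudogroup, SAWRestrictionDescent, SAWPtolemyBoundary).
Crux, BY NAME: `Summit.CriticalPhenomena.SAWScalingLimit.Theses.SAWRestrictionRigidity.LimitExists` —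
the critical `δℤ²` SAW laws have a FULL scaling limit as a chordal curve family:
`∃ P, P.IsChordal ∧ ∀ D a b, IsEndpointApprox D a b → TendstoLaw (curve) (SAW.law D δ (a δ) (b δ)) id (P D)`.

## The line

Billingsley's subsequence principle along the countably generated filter `𝓝[>] 0`: `LimitExists` =
(existence of subsequential limits: eventual tightness + Prokhorov past the junk meshes) + (uniqueness of
subsequential limits across mesh sequences AND endpoint approximations, cut along the route's PROVED
engine `AvoidanceDeterminesLaw_holds`, stmt-1373: two probability laws carried by simple boundary-avoiding
chords with equal hull-subdomain avoidance masses are equal) + (chordality: tree lemmas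
`ae_endpoints_of_hyps`, `ae_range_subset_closure_of_hyps`).

## v2 reshape (lead c1)

v1 had three stubs (T) = item 1372, (S) = item 4982, (A) = NEW "avoidance agreement of two subsequential
limits".  (A) is NOT an independent open input: it follows from the route's own r3 item (C)
`AvoidanceCocycleLimit` (stmt-1369) and PROVABLE glue, because the planar-topology heart of the `≤` half
of the portmanteau sandwich — outer approximation of a hull subdomain by carved hull SUPER-domains — is
already the tree theorem `AvoidancePassage.exists_superdomain` (files
`Theorems/SAWLoopFugacityFlowAvoidancePassageSandwich/…`, the engine of the proved `avoidancePassage_proof`,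
stmt-4984), and the a.e. carrier clause that engine needs for the comparison measure is exactly what (S)
delivers for the OTHER subsequential limit.  Registered stubs of v2 (six ≤ stubs_max = 7):

* `stub_eventualTight` (T) — VERBATIM item stmt-1372 `EventualTight` (`Iff.rfl` pin below).  OPEN lattice
  statement (no annulus-crossing bound at `x_c`); staffed under its own crux directory.
* `stub_simpleSubseqLimits` (S) — VERBATIM the shared crux stmt-4982 `SimpleSubseqLimits` (`Iff.rfl` pin).
  OPEN; staffed (Cruxes/SimpleSubseqLimits).
* `stub_avoidanceCocycleLimit` (C) — VERBATIM this route's r3 crux stmt-1369 `AvoidanceCocycleLimit`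
  (`Iff.rfl` pin): the lattice avoidance probability of a hull subdomain converges along the FULL filter
  `δ → 0⁺`.  OPEN lattice statement.
* `stub_interleave` (I) — PROVABLE glue: full-filter limits of ANY mesh functional of the endpoints are
  approximation-free, by interleaving two endpoint approximations on a set `S ⊆ ℝ` with both `S` and `Sᶜ`
  accumulating at `0⁺` (`IsEndpointApprox` is closed under `Set.piecewise`; limits along the two NeBot
  restrictions are unique in the T2 space `ℝ≥0∞`).
* `stub_portmanteau` (P) — PROVABLE glue: closed/open portmanteau inequalities for a probability weak limit
  of the pushed critical SAW laws along a sequence (the laws have mass `0` or `1`, hence are probability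
  measures eventually; Mathlib's `ProbabilityMeasure.limsup_measure_closed_le_of_tendsto` /
  `le_liminf_measure_open_of_tendsto`; cf. the inlined version inside `avoidancePassage_proof`).
* `stub_avoidanceSandwich` (W) — PROVABLE glue, the `≤` half: if `ν` satisfies the open portmanteau
  inequality along `(a, b, s)`, `ν'` is carried by curves in `cl D` meeting `∂D` only at `a, b`, and on
  every hull super-domain `E` of `D` the avoidance probabilities along `s` converge to some `c_E ≤ ν'(range
  ⊆ cl E)`, then `ν(range ⊆ cl D') ≤ ν'(range ⊆ cl D')` for every Dobrushin `D' ⊆ D` with the same marked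
  points (carve `D ∖ cl D'` by `exists_superdomain`, open events `rangeSubset Tᶜ`, monotone limit using the
  carrier of `ν'` — verbatim the architecture of `avoidancePassage_proof` with the SLE law replaced by `ν'`).

PROVED here (no sorry): `exists_subseqLimit` (Prokhorov past the junk meshes), `avoidanceAgreement_of_stubs :
(S) → (C) → (I) → (P) → (W) → (A)` (closed half of portmanteau bounds the common, approximation-free cocycle
limit by both subsequential limits from below; (W) twice gives the two inequalities), and the composition
`exists_isScalingLimitFamily_of (hT) (hS) (hC) (hI) (hP) (hW)`, whence `LimitExists_of (hT) (hS) (hC) : LimitExists`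
BY NAME with (I), (P), (W) discharged by the landed theorems: the crux is closed modulo exactly the three
EXISTING items 1372 ∧ 4982 ∧ 1369.

Sorries (v4 = v3): exactly 3 = `stub_eventualTight`, `stub_simpleSubseqLimits`, `stub_avoidanceCocycleLimit`
(items 1372 / 4982 / 1369 verbatim); the glue stubs (I), (P), (W) are discharged by the landed tree theorems.
Disproof used: none exists for this crux (`ledger crux ls`, 2026-08-17T10:53Z, lead c4).
Negatives honoured: stmt-0772 (all-`δ` tightness, refuted) is NOT used — (T) is its `∃ δ₀` repair.
-/

noncomputable section

open MeasureTheory Filter Topology Set Metric Function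
open Literature.Probability.RandomPlanarGeometry Literature.Probability.RandomPlanarGeometry.SAW
open Literature.Probability.LatticeModels
open scoped ENNReal NNReal BoundedContinuousFunction MeasureTheory Topology ProbabilityTheory

namespace Summit.CriticalPhenomena.SAWScalingLimit.Cruxes.LimitExists.Birth

open Summit.CriticalPhenomena.SAWScalingLimit.Theses.SAWRestrictionRigidity
  (LimitExists EventualTight AvoidanceCocycleLimit AvoidanceDeterminesLaw AvoidanceDeterminesLaw_holds)
open Summit.CriticalPhenomena.SAWScalingLimit.Theorems.SubseqIdentification.Negative
  (eventually_isProbabilityMeasure_law isProbabilityMeasure_of_hyps ae_endpoints_of_hyps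
    ae_range_subset_closure_of_hyps)

/-! ## The registered stubs -/

/-- **stub (T) — EVENTUAL TIGHTNESS** (verbatim the shared support item `EventualTight`,
stmt-CriticalPhenomena-1372): for every Dobrushin domain and endpoint approximation there is `δ₀ > 0`
such that the pushed-forward critical SAW laws for `δ ∈ (0, δ₀]` form a tight set of measures on
`CurveClass ℂ`.  OPEN: needs an annulus-crossing / no-macroscopic-oscillation bound for the critical
SAW (Aizenman–Burchard regularity; Kemppainen–Smirnov Condition G2 is for FKG models).
Sources: KemppainenSmirnov2017 Thm 1.5, AizenmanBurchardDuke1999 Thm 1.1, DuminilCopinHammond2013. -/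
theorem stub_eventualTight : ∀ (D : Literature.Probability.RandomPlanarGeometry.DobrushinDomain) (a b : ℝ → Literature.Probability.LatticeModels.Site 2), Literature.Probability.RandomPlanarGeometry.SAW.IsEndpointApprox D a b → ∃ δ₀ : ℝ, 0 < δ₀ ∧ MeasureTheory.IsTightMeasureSet ((fun δ => (Literature.Probability.RandomPlanarGeometry.SAW.law D.carrier δ (a δ) (b δ)).map (fun γ => γ.curve)) '' Set.Ioc 0 δ₀) := by
  sorry

/-- **stub (S) — SIMPLE BOUNDARY-AVOIDING SUBSEQUENTIAL LIMITS** (verbatim the shared crux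
`SimpleSubseqLimits`, stmt-CriticalPhenomena-4982): every probability measure that is the weak limit
of the pushed-forward critical SAW laws along a mesh sequence `sₙ → 0⁺` is carried by simple curve
classes from `a = D.pt 0` to `b = D.pt 1` with range in `cl D` meeting `∂D` only at `a, b` (exactly
the carrier clause of `AvoidanceDeterminesLaw`).  OPEN: weak limits of simple polylines need not be
simple; needs no-retracing and no-boundary-crawling bounds at `x_c`.
Sources: LawlerSchrammWerner2004SAW §3.4, KennedyLawler2013, DuminilCopinHammond2013. -/
theorem stub_simpleSubseqLimits : ∀ (D : Literature.Probability.RandomPlanarGeometry.DobrushinDomain) (a b : ℝ → Literature.Probability.LatticeModels.Site 2), Literature.Probability.RandomPlanarGeometry.SAW.IsEndpointApprox D a b → ∀ (s : ℕ → ℝ) (ν : MeasureTheory.Measure (Literature.Probability.RandomPlanarGeometry.CurveClass ℂ)), Filter.Tendsto s Filter.atTop (nhdsWithin 0 (Set.Ioi 0)) → MeasureTheory.IsProbabilityMeasure ν → (∀ f : BoundedContinuousFunction (Literature.Probability.RandomPlanarGeometry.CurveClass ℂ) ℝ, Filter.Tendsto (fun n => ∫ γ, f γ.curve ∂(Literature.Probability.RandomPlanarGeometry.SAW.law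 D.carrier (s n) (a (s n)) (b (s n)))) Filter.atTop (nhds (∫ x, f x ∂ν))) → ∀ᵐ γ ∂ν, γ ∈ Literature.Probability.RandomPlanarGeometry.CurveClass.simple ∧ γ.source = D.pt 0 ∧ γ.target = D.pt 1 ∧ γ.range ⊆ closure D.carrier ∧ γ.range ∩ frontier D.carrier ⊆ {D.pt 0, D.pt 1} := by
  sorry

/-- **stub (C) — AVOIDANCE COCYCLE LIMIT** (verbatim this route's r3 crux `AvoidanceCocycleLimit`,
stmt-CriticalPhenomena-1369): for Dobrushin `D' ⊆ D` with the same marked points and agreeing with `D`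
near `a` and `b`, and any endpoint approximation, the critical SAW probability
`P_δ(range ⊆ cl D')` (`= Z_δ(D')/Z_δ(D)` up to largest-component bookkeeping) converges as `δ → 0⁺`
along the FULL filter to some `c ∈ [0, 1]` (no claim on the value).  OPEN lattice statement (no
monotonicity in `δ`; LSW04 Prediction: a conformal quantity to the power `5/8`).
Sources: LawlerSchrammWerner2004SAW §3.4.2–3.4.5 and §4.1, KennedyLawler2013 §1, arXiv:1008.4321 §3.1. -/
theorem stub_avoidanceCocycleLimit : ∀ (D D' : Literature.Probability.RandomPlanarGeometry.DobrushinDomain) (a b : ℝ → Literature.Probability.LatticeModels.Site 2), Literature.Probability.RandomPlanarGeometry.SAW.IsEndpointApprox D a b → D'.carrier ⊆ D.carrier → D'.pt 0 = D.pt 0 → D'.pt 1 = D.pt 1 → (∃ ε : ℝ, 0 < ε ∧ D'.carrier ∩ Metric.ball (D.pt 0) ε = D.carrier ∩ Metric.ball (D.pt 0) ε ∧ D'.carrier ∩ Metric.ball (D.pt 1) ε = D.carrier ∩ Metric.ball (D.pt 1) ε) → ∃ c : ENNReal, Filter.Tendsto (fun δ => (((Literature.Probability.RandomPlanarGeometry.SAW.law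 D.carrier δ (a δ) (b δ)).map (fun γ => γ.curve)) (Literature.Probability.RandomPlanarGeometry.CurveClass.rangeSubset (closure D'.carrier)))) (nhdsWithin 0 (Set.Ioi 0)) (nhds c) := by
  sorry

/-- **stub (I) — INTERLEAVING: full-filter limits are approximation-free** (provable glue).  For a
Dobrushin domain `D` and ANY functional `g δ x y ∈ ℝ≥0∞` of the mesh and the two lattice endpoints: if
`g δ (a δ) (b δ)` has a limit along `δ → 0⁺` for EVERY endpoint approximation `(a, b)` of `D`, then the
limits along any two endpoint approximations coincide.  Proof idea: pick `S ⊆ ℝ` with `S` and `Sᶜ`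
both accumulating at `0⁺` (e.g. `S = {1/(n+1)}`); the interleaved approximation `S.piecewise a a'`,
`S.piecewise b b'` is again an endpoint approximation (`Filter.Tendsto.piecewise`, eventual reachability),
its limit agrees with the first along `𝓝[>] 0 ⊓ 𝓟 S` and with the second along `𝓝[>] 0 ⊓ 𝓟 Sᶜ`, both
NeBot, and `ℝ≥0∞` is T2.  [folklore; the "interleave two approximations" step of the route rationale] -/
theorem stub_interleave : ∀ (D : Literature.Probability.RandomPlanarGeometry.DobrushinDomain) (g : ℝ → Literature.Probability.LatticeModels.Site 2 → Literature.Probability.LatticeModels.Site 2 → ENNReal), (∀ a b : ℝ → Literature.Probability.LatticeModels.Site 2, Literature.Probability.RandomPlanarGeometry.SAW.IsEndpointApprox D a b → ∃ c : ENNReal, Filter.Tendsto (fun δ => g δ (a δ) (b δ)) (nhdsWithin 0 (Set.Ioi 0)) (nhds c)) → ∀ (a b a' b' : ℝ → Literature.Probability.LatticeModels.Site 2) (c c' : ENNReal), Literature.Probability.RandomPlanarGeometry.SAW.IsEndpointApprox D a b → Literature.Probability.RandomPlanarGeometry.SAW.IsEndpointApprox D a' b' → Filter.Tendsto (fun δ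 => g δ (a δ) (b δ)) (nhdsWithin 0 (Set.Ioi 0)) (nhds c) → Filter.Tendsto (fun δ => g δ (a' δ) (b' δ)) (nhdsWithin 0 (Set.Ioi 0)) (nhds c') → c = c' := by
  exact Summit.CriticalPhenomena.SAWScalingLimit.Theorems.SAWRestrictionRigidityLimitExists.stub_interleave

/-- **stub (P) — PORTMANTEAU FOR SUBSEQUENTIAL SAW LIMITS** (provable glue).  If `ν` is a probability
measure and the test integrals `∫ f(γ.curve) dP_{s n}` of the critical SAW laws of `Ω` along a sequence of
meshes `s n` with endpoints `a (s n)`, `b (s n)` converge to `∫ f dν` for every bounded continuous `f`,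
then for the pushed-forward laws `Pₙ = (law …).map curve`: `limsup Pₙ(C) ≤ ν(C)` for closed `C` and
`ν(G) ≤ liminf Pₙ(G)` for open `G`.  (The SAW law has total mass `0` or `1`; testing `f ≡ 1` makes it a
probability measure eventually, and Mathlib's portmanteau for `ProbabilityMeasure` applies to the
eventually-equal sequence; this is the inlined opening of `avoidancePassage_proof`.)
[cite: BillingsleyCPM1999, Thm. 2.1] -/
theorem stub_portmanteau : ∀ (Ω : Set ℂ) (a b : ℝ → Literature.Probability.LatticeModels.Site 2) (s : ℕ → ℝ) (ν : MeasureTheory.Measure (Literature.Probability.RandomPlanarGeometry.CurveClass ℂ)), MeasureTheory.IsProbabilityMeasure ν → (∀ f : BoundedContinuousFunction (Literature.Probability.RandomPlanarGeometry.CurveClass ℂ) ℝ, Filter.Tendsto (fun n => ∫ γ, f γ.curve ∂(Literature.Probability.RandomPlanarGeometry.SAW.law Ω (s n) (a (s n)) (b (s n)))) Filter.atTop (nhds (∫ x, f x ∂ν))) → (∀ C : Set (Literature.Probability.RandomPlanarGeometry.CurveClass ℂ), IsClosed C → Filter.limsup (fun n => ((Literature.Probability.RandomPlanarGeometry.SAW.law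 Ω (s n) (a (s n)) (b (s n))).map (fun γ => γ.curve)) C) Filter.atTop ≤ ν C) ∧ (∀ G : Set (Literature.Probability.RandomPlanarGeometry.CurveClass ℂ), IsOpen G → ν G ≤ Filter.liminf (fun n => ((Literature.Probability.RandomPlanarGeometry.SAW.law Ω (s n) (a (s n)) (b (s n))).map (fun γ => γ.curve)) G) Filter.atTop) := by
  exact Summit.CriticalPhenomena.SAWScalingLimit.Theorems.SAWRestrictionRigidityLimitExists.stub_portmanteau

/-- **stub (W) — THE AVOIDANCE SANDWICH** (provable glue; the `≤` half of the portmanteau passage for two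
subsequential limits).  Let `ν`, `ν'` be probability measures on curves, `(a, b)` an endpoint
approximation of the Dobrushin domain `D` and `s n → 0⁺`.  Assume: the open portmanteau inequality
`ν(G) ≤ liminf Pₙ(G)` for the pushed-forward critical SAW laws `Pₙ` along `(a, b, s)`; `ν'`-a.e. curve has
range in `cl D` meeting `∂D` only at the marked points; and for every hull super-domain `E` of `D`
(Dobrushin, `E ⊆ D`, same marked points, agreeing with `D` near them) the avoidance probabilities
`Pₙ(range ⊆ cl E)` converge to some `c_E ≤ ν'(range ⊆ cl E)`.  Then `ν(range ⊆ cl D') ≤ ν'(range ⊆ cl D')`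
for every Dobrushin `D' ⊆ D` with the same marked points.  Proof architecture = `avoidancePassage_proof`
(stmt-4984) with the SLE law replaced by `ν'`: exhaust `D ∖ cl D'` by compacts `K_k`, carve hull
super-domains `E_k = D ∖ T_k ⊇ D'` missing `K_k` (`AvoidancePassage.exists_superdomain`,
`exists_ball_inter_eq`), use the OPEN events `rangeSubset T_kᶜ` and `Pₙ(range ⊄ cl D) = 0` eventually
(`range_curve_subset_closure`, `eventually_ne_of_hyps`), then `ν'(range ⊆ cl E_k) ↓ ν'(range ⊆ cl D')`
along the carrier of `ν'`.  [folklore] -/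
theorem stub_avoidanceSandwich : ∀ (D : Literature.Probability.RandomPlanarGeometry.DobrushinDomain) (a b : ℝ → Literature.Probability.LatticeModels.Site 2), Literature.Probability.RandomPlanarGeometry.SAW.IsEndpointApprox D a b → ∀ (s : ℕ → ℝ) (ν ν' : MeasureTheory.Measure (Literature.Probability.RandomPlanarGeometry.CurveClass ℂ)), Filter.Tendsto s Filter.atTop (nhdsWithin 0 (Set.Ioi 0)) → MeasureTheory.IsProbabilityMeasure ν → MeasureTheory.IsProbabilityMeasure ν' → (∀ G : Set (Literature.Probability.RandomPlanarGeometry.CurveClass ℂ), IsOpen G → ν G ≤ Filter.liminf (fun n => ((Literature.Probability.RandomPlanarGeometry.SAW.law D.carrier (s n) (a (s n)) (b (s n))).map (fun γ => γ.curve)) G) Filter.atTop) → (∀ᵐ γ ∂ν', γ.range ⊆ closure D.carrier ∧ γ.range ∩ frontier D.carrier ⊆ {D.pt 0, D.pt 1}) → (∀ E : Literature.Probability.RandomPlanarGeometry.DobrushinDomain, E.carrier ⊆ D.carrier → E.pt 0 = D.pt 0 → E.pt 1 = D.pt 1 → (∃ ε : ℝ, 0 < ε ∧ E.carrier ∩ Metric.ball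 (D.pt 0) ε = D.carrier ∩ Metric.ball (D.pt 0) ε ∧ E.carrier ∩ Metric.ball (D.pt 1) ε = D.carrier ∩ Metric.ball (D.pt 1) ε) → ∃ c : ENNReal, Filter.Tendsto (fun n => ((Literature.Probability.RandomPlanarGeometry.SAW.law D.carrier (s n) (a (s n)) (b (s n))).map (fun γ => γ.curve)) (Literature.Probability.RandomPlanarGeometry.CurveClass.rangeSubset (closure E.carrier))) Filter.atTop (nhds c) ∧ c ≤ ν' (Literature.Probability.RandomPlanarGeometry.CurveClass.rangeSubset (closure E.carrier))) → ∀ D' : Literature.Probability.RandomPlanarGeometry.DobrushinDomain, D'.carrier ⊆ D.carrier → D'.pt 0 = D.pt 0 → D'.pt 1 = D.pt 1 → ν (Literature.Probability.RandomPlanarGeometry.CurveClass.rangeSubset (closure D'.carrier)) ≤ ν' (Literature.Probability.RandomPlanarGeometry.CurveClass.rangeSubset (closure D'.carrier)) := by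
  exact Summit.CriticalPhenomena.SAWScalingLimit.Theorems.SAWRestrictionRigidityLimitExists.stub_avoidanceSandwich

/-! ## Name-keyed aliases of the stub statements (skeleton-check convention: the hypotheses of
`LimitExists_of` are exactly the declared stubs, each BY NAME) -/

namespace Registered

/-- Alias keyed by the stub name: the statement of `stub_eventualTight` (= item stmt-1372 `EventualTight`). -/
abbrev stub_eventualTight : Prop :=
  ∀ (D : Literature.Probability.RandomPlanarGeometry.DobrushinDomain) (a b : ℝ → Literature.Probability.LatticeModels.Site 2), Literature.Probability.RandomPlanarGeometry.SAW.IsEndpointApprox D a b → ∃ δ₀ : ℝ, 0 < δ₀ ∧ MeasureTheory.IsTightMeasureSet ((fun δ => (Literature.Probability.RandomPlanarGeometry.SAW.law D.carrier δ (a δ) (b δ)).map (fun γ => γ.curve)) '' Set.Ioc 0 δ₀)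

/-- Alias keyed by the stub name: the statement of `stub_simpleSubseqLimits` (= item stmt-4982 `SimpleSubseqLimits`). -/
abbrev stub_simpleSubseqLimits : Prop :=
  ∀ (D : Literature.Probability.RandomPlanarGeometry.DobrushinDomain) (a b : ℝ → Literature.Probability.LatticeModels.Site 2), Literature.Probability.RandomPlanarGeometry.SAW.IsEndpointApprox D a b → ∀ (s : ℕ → ℝ) (ν : MeasureTheory.Measure (Literature.Probability.RandomPlanarGeometry.CurveClass ℂ)), Filter.Tendsto s Filter.atTop (nhdsWithin 0 (Set.Ioi 0)) → MeasureTheory.IsProbabilityMeasure ν → (∀ f : BoundedContinuousFunction (Literature.Probability.RandomPlanarGeometry.CurveClass ℂ) ℝ, Filter.Tendsto (fun n => ∫ γ, f γ.curve ∂(Literature.Probability.RandomPlanarGeometry.SAW.law D.carrier (s n) (a (s n)) (b (s n)))) Filter.atTop (nhds (∫ x, f x ∂ν))) → ∀ᵐ γ ∂ν, γ ∈ Literature.Probability.RandomPlanarGeometry.CurveClass.simple ∧ γ.source = D.pt 0 ∧ γ.target = D.pt 1 ∧ γ.range ⊆ closure D.carrier ∧ γ.range ∩ frontier D.carrier ⊆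 {D.pt 0, D.pt 1}

/-- Alias keyed by the stub name: the statement of `stub_avoidanceCocycleLimit` (= item stmt-1369 `AvoidanceCocycleLimit`). -/
abbrev stub_avoidanceCocycleLimit : Prop :=
  ∀ (D D' : Literature.Probability.RandomPlanarGeometry.DobrushinDomain) (a b : ℝ → Literature.Probability.LatticeModels.Site 2), Literature.Probability.RandomPlanarGeometry.SAW.IsEndpointApprox D a b → D'.carrier ⊆ D.carrier → D'.pt 0 = D.pt 0 → D'.pt 1 = D.pt 1 → (∃ ε : ℝ, 0 < ε ∧ D'.carrier ∩ Metric.ball (D.pt 0) ε = D.carrier ∩ Metric.ball (D.pt 0) ε ∧ D'.carrier ∩ Metric.ball (D.pt 1) ε = D.carrier ∩ Metric.ball (D.pt 1) ε) → ∃ c : ENNReal, Filter.Tendsto (fun δ => (((Literature.Probability.RandomPlanarGeometry.SAW.law D.carrier δ (a δ) (b δ)).map (fun γ => γ.curve)) (Literature.Probability.RandomPlanarGeometry.CurveClass.rangeSubset (closure D'.carrier)))) (nhdsWithin 0 (Set.Ioi 0)) (nhds c)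

/-- Alias keyed by the stub name: the statement of `stub_interleave` (provable glue). -/
abbrev stub_interleave : Prop :=
  ∀ (D : Literature.Probability.RandomPlanarGeometry.DobrushinDomain) (g : ℝ → Literature.Probability.LatticeModels.Site 2 → Literature.Probability.LatticeModels.Site 2 → ENNReal), (∀ a b : ℝ → Literature.Probability.LatticeModels.Site 2, Literature.Probability.RandomPlanarGeometry.SAW.IsEndpointApprox D a b → ∃ c : ENNReal, Filter.Tendsto (fun δ => g δ (a δ) (b δ)) (nhdsWithin 0 (Set.Ioi 0)) (nhds c)) → ∀ (a b a' b' : ℝ → Literature.Probability.LatticeModels.Site 2) (c c' : ENNReal), Literature.Probability.RandomPlanarGeometry.SAW.IsEndpointApprox D a b → Literature.Probability.RandomPlanarGeometry.SAW.IsEndpointApprox D a' b' → Filter.Tendsto (fun δ => g δ (a δ) (b δ)) (nhdsWithin 0 (Set.Ioi 0)) (nhds c) → Filter.Tendsto (fun δ => g δ (a' δ) (b' δ)) (nhdsWithin 0 (Set.Ioi 0)) (nhds c') → c = c'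

/-- Alias keyed by the stub name: the statement of `stub_portmanteau` (provable glue). -/
abbrev stub_portmanteau : Prop :=
  ∀ (Ω : Set ℂ) (a b : ℝ → Literature.Probability.LatticeModels.Site 2) (s : ℕ → ℝ) (ν : MeasureTheory.Measure (Literature.Probability.RandomPlanarGeometry.CurveClass ℂ)), MeasureTheory.IsProbabilityMeasure ν → (∀ f : BoundedContinuousFunction (Literature.Probability.RandomPlanarGeometry.CurveClass ℂ) ℝ, Filter.Tendsto (fun n => ∫ γ, f γ.curve ∂(Literature.Probability.RandomPlanarGeometry.SAW.law Ω (s n) (a (s n)) (b (s n)))) Filter.atTop (nhds (∫ x, f x ∂ν))) → (∀ C : Set (Literature.Probability.RandomPlanarGeometry.CurveClass ℂ), IsClosed C → Filter.limsup (fun n => ((Literature.Probability.RandomPlanarGeometry.SAW.law Ω (s n) (a (s n)) (b (s n))).map (fun γ => γ.curve)) C) Filter.atTop ≤ ν C) ∧ (∀ G : Set (Literature.Probability.RandomPlanarGeometry.CurveClass ℂ), IsOpen G → ν G ≤ Filter.liminf (fun n => ((Literature.Probability.RandomPlanarGeometry.SAW.law Ω (s n) (a (s n)) (b (s n))).map (fun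 γ => γ.curve)) G) Filter.atTop)

/-- Alias keyed by the stub name: the statement of `stub_avoidanceSandwich` (provable glue). -/
abbrev stub_avoidanceSandwich : Prop :=
  ∀ (D : Literature.Probability.RandomPlanarGeometry.DobrushinDomain) (a b : ℝ → Literature.Probability.LatticeModels.Site 2), Literature.Probability.RandomPlanarGeometry.SAW.IsEndpointApprox D a b → ∀ (s : ℕ → ℝ) (ν ν' : MeasureTheory.Measure (Literature.Probability.RandomPlanarGeometry.CurveClass ℂ)), Filter.Tendsto s Filter.atTop (nhdsWithin 0 (Set.Ioi 0)) → MeasureTheory.IsProbabilityMeasure ν → MeasureTheory.IsProbabilityMeasure ν' → (∀ G : Set (Literature.Probability.RandomPlanarGeometry.CurveClass ℂ), IsOpen G → ν G ≤ Filter.liminf (fun n => ((Literature.Probability.RandomPlanarGeometry.SAW.law D.carrier (s n) (a (s n)) (b (s n))).map (fun γ => γ.curve)) G) Filter.atTop) → (∀ᵐ γ ∂ν', γ.range ⊆ closure D.carrier ∧ γ.range ∩ frontier D.carrier ⊆ {D.pt 0, D.pt 1}) → (∀ E : Literature.Probability.RandomPlanarGeometry.DobrushinDomain, E.carrier ⊆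 D.carrier → E.pt 0 = D.pt 0 → E.pt 1 = D.pt 1 → (∃ ε : ℝ, 0 < ε ∧ E.carrier ∩ Metric.ball (D.pt 0) ε = D.carrier ∩ Metric.ball (D.pt 0) ε ∧ E.carrier ∩ Metric.ball (D.pt 1) ε = D.carrier ∩ Metric.ball (D.pt 1) ε) → ∃ c : ENNReal, Filter.Tendsto (fun n => ((Literature.Probability.RandomPlanarGeometry.SAW.law D.carrier (s n) (a (s n)) (b (s n))).map (fun γ => γ.curve)) (Literature.Probability.RandomPlanarGeometry.CurveClass.rangeSubset (closure E.carrier))) Filter.atTop (nhds c) ∧ c ≤ ν' (Literature.Probability.RandomPlanarGeometry.CurveClass.rangeSubset (closure E.carrier))) → ∀ D' : Literature.Probability.RandomPlanarGeometry.DobrushinDomain, D'.carrier ⊆ D.carrier → D'.pt 0 = D.pt 0 → D'.pt 1 = D.pt 1 → ν (Literature.Probability.RandomPlanarGeometry.CurveClass.rangeSubset (closure D'.carrier)) ≤ ν' (Literature.Probability.RandomPlanarGeometry.CurveClass.rangeSubset (closure D'.carrier))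

end Registered

/-! ## Proved glue 1: Prokhorov past the junk meshes -/

/-- **Subsequential limits exist under eventual tightness.**  If the pushed-forward critical SAW laws
are a tight set for `δ ∈ (0, δ₀]`, then along every mesh sequence `sₙ → 0⁺` some subsequence converges
weakly (bounded continuous test functions of `γ.curve`) to a probability measure.  The SAW law is a
probability measure only for small `δ` (junk value `0` when `a_δ, b_δ` are not joined), so Prokhorov
(`IsTightAlongMesh.exists_subseq`) is run on the surrogate family "push-forward law if it is a
probability measure, else a Dirac mass", which agrees with the push-forward laws on a germ at `0⁺`
(`eventually_isProbabilityMeasure_law`). [cite: BillingsleyCPM1999, Thm. 5.1] -/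
theorem exists_subseqLimit {D : DobrushinDomain} {a b : ℝ → Site 2} (hab : SAW.IsEndpointApprox D a b)
    {δ₀ : ℝ} (hδ₀ : 0 < δ₀)
    (htight : IsTightMeasureSet ((fun δ => (SAW.law D.carrier δ (a δ) (b δ)).map
      (fun γ => γ.curve)) '' Set.Ioc 0 δ₀))
    {s : ℕ → ℝ} (hs : Tendsto s atTop (𝓝[>] (0 : ℝ))) :
    ∃ (φ : ℕ → ℕ) (ν : Measure (CurveClass ℂ)), StrictMono φ ∧ IsProbabilityMeasure ν ∧
      ∀ f : CurveClass ℂ →ᵇ ℝ, Tendsto (fun n => ∫ γ, f γ.curve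
        ∂(SAW.law D.carrier (s (φ n)) (a (s (φ n))) (b (s (φ n))))) atTop (𝓝 (∫ x, f x ∂ν)) := by
  classical
  -- the push-forward laws and the surrogate family of probability laws on the curve space
  obtain ⟨L, hL⟩ : ∃ L : ℝ → Measure (CurveClass ℂ), ∀ δ, L δ =
      (SAW.law D.carrier δ (a δ) (b δ)).map (fun γ => γ.curve) := ⟨_, fun _ => rfl⟩
  obtain ⟨μ, hμ⟩ : ∃ μ : ℝ → Measure (CurveClass ℂ), ∀ δ, μ δ =
      if IsProbabilityMeasure (L δ) then L δ
      else Measure.dirac (CurveClass.mk (Curve.const 0)) := ⟨_, fun _ => rfl⟩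
  have hμprob : ∀ δ, IsProbabilityMeasure (μ δ) := by
    intro δ
    by_cases h : IsProbabilityMeasure (L δ)
    · rw [hμ δ, if_pos h]; exact h
    · rw [hμ δ, if_neg h]; infer_instance
  -- for all small `δ` the surrogate IS the push-forward law
  have hev : ∀ᶠ δ in 𝓝[>] (0 : ℝ), μ δ = L δ := by
    filter_upwards [eventually_isProbabilityMeasure_law hab] with δ hδ
    haveI := hδ
    have hp : IsProbabilityMeasure (L δ) := by
      rw [hL δ]
      exact Measure.isProbabilityMeasure_map (SAW.aemeasurable_curve _ _ _ _)
    rw [hμ δ, if_pos hp]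
  -- tightness along the mesh of the surrogate family, observed through the identity
  have hT : IsTightAlongMesh (Ωδ := fun _ : ℝ => CurveClass ℂ)
      (fun (_ : ℝ) (x : CurveClass ℂ) => x) μ := by
    intro ε hε
    obtain ⟨K, hK, hbK⟩ :=
      (isTightMeasureSet_iff_exists_isCompact_measure_compl_le.1 htight) ε hε
    refine ⟨K, hK, ?_⟩
    filter_upwards [hev, Ioc_mem_nhdsGT hδ₀] with δ hδ hδI
    show μ δ Kᶜ ≤ ε
    rw [hδ, hL δ]
    exact hbK _ ⟨δ, hδI, rfl⟩
  haveI : ∀ δ, IsProbabilityMeasure (μ δ) := hμprob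
  obtain ⟨φ, ν, hφ, hν, hlim⟩ :=
    hT.exists_subseq (Filter.Eventually.of_forall fun δ => aemeasurable_id') hs
  refine ⟨φ, ν, hφ, hν, fun f => ?_⟩
  have hs' : Tendsto (fun n => s (φ n)) atTop (𝓝[>] (0 : ℝ)) := hs.comp hφ.tendsto_atTop
  refine (hlim f).congr' ?_
  filter_upwards [hs'.eventually hev] with n hn
  have hn' : μ (s (φ n)) = L (s (φ n)) := hn
  show ∫ x, f x ∂(μ (s (φ n))) = ∫ γ, f γ.curve ∂(SAW.law D.carrier (s (φ n)) (a (s (φ n))) (b (s (φ n))))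
  rw [hn', hL]
  exact integral_map (SAW.aemeasurable_curve _ _ _ _) f.continuous.aestronglyMeasurable

/-! ## Proved glue 2: avoidance agreement of two subsequential limits from (S), (C), (I), (P), (W) -/

/-- **Avoidance agreement** (the v1 stub (A), now PROVED from the registered stubs).  For one Dobrushin
domain `D`, two endpoint approximations, two mesh sequences `s, s' → 0⁺` and two probability weak limits
`ν, ν'` of the corresponding pushed-forward critical SAW laws, `ν(range ⊆ cl D') = ν'(range ⊆ cl D')` for
every hull subdomain `D'` (Dobrushin, `D' ⊆ D`, same marked points, agreeing with `D` near them).  For each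
hull super-domain `E`: (C) gives the full-filter limits `c_E`, `c'_E` of the avoidance probability along
the two approximations, (I) gives `c_E = c'_E`, the closed half of (P) gives `c'_E ≤ ν'(range ⊆ cl E)`;
then (W) (fed with the open half of (P) for `ν` and the carrier of `ν'` from (S)) gives `ν ≤ ν'` on the
event, and symmetrically. [folklore] -/
theorem avoidanceAgreement_of_stubs (hS : Registered.stub_simpleSubseqLimits)
    (hC : Registered.stub_avoidanceCocycleLimit) (hI : Registered.stub_interleave)
    (hM : Registered.stub_portmanteau) (hW : Registered.stub_avoidanceSandwich) :
    ∀ (D : DobrushinDomain) (a b a' b' : ℝ → Site 2), SAW.IsEndpointApprox D a b →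
      SAW.IsEndpointApprox D a' b' → ∀ (s s' : ℕ → ℝ) (ν ν' : Measure (CurveClass ℂ)),
      Tendsto s atTop (𝓝[>] (0 : ℝ)) → Tendsto s' atTop (𝓝[>] (0 : ℝ)) →
      IsProbabilityMeasure ν → IsProbabilityMeasure ν' →
      (∀ f : CurveClass ℂ →ᵇ ℝ, Tendsto (fun n => ∫ γ, f γ.curve
        ∂(SAW.law D.carrier (s n) (a (s n)) (b (s n)))) atTop (𝓝 (∫ x, f x ∂ν))) →
      (∀ f : CurveClass ℂ →ᵇ ℝ, Tendsto (fun n => ∫ γ, f γ.curve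
        ∂(SAW.law D.carrier (s' n) (a' (s' n)) (b' (s' n)))) atTop (𝓝 (∫ x, f x ∂ν'))) →
      ∀ D' : DobrushinDomain, D'.carrier ⊆ D.carrier → D'.pt 0 = D.pt 0 → D'.pt 1 = D.pt 1 →
      (∃ ε : ℝ, 0 < ε ∧ D'.carrier ∩ ball (D.pt 0) ε = D.carrier ∩ ball (D.pt 0) ε ∧
        D'.carrier ∩ ball (D.pt 1) ε = D.carrier ∩ ball (D.pt 1) ε) →
      ν (CurveClass.rangeSubset (closure D'.carrier)) =
        ν' (CurveClass.rangeSubset (closure D'.carrier)) := by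
  intro D a b a' b' hab hab' s s' ν ν' hs hs' hν hν' hlim hlim' D' hsub h0 h1 _
  -- one-sided comparison for an ordered pair of subsequential limits of `D`
  have key : ∀ {a b a' b' : ℝ → Site 2} {s s' : ℕ → ℝ} {ν ν' : Measure (CurveClass ℂ)},
      SAW.IsEndpointApprox D a b → SAW.IsEndpointApprox D a' b' →
      Tendsto s atTop (𝓝[>] (0 : ℝ)) → Tendsto s' atTop (𝓝[>] (0 : ℝ)) →
      IsProbabilityMeasure ν → IsProbabilityMeasure ν' →
      (∀ f : CurveClass ℂ →ᵇ ℝ, Tendsto (fun n => ∫ γ, f γ.curve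
        ∂(SAW.law D.carrier (s n) (a (s n)) (b (s n)))) atTop (𝓝 (∫ x, f x ∂ν))) →
      (∀ f : CurveClass ℂ →ᵇ ℝ, Tendsto (fun n => ∫ γ, f γ.curve
        ∂(SAW.law D.carrier (s' n) (a' (s' n)) (b' (s' n)))) atTop (𝓝 (∫ x, f x ∂ν'))) →
      ν (CurveClass.rangeSubset (closure D'.carrier)) ≤
        ν' (CurveClass.rangeSubset (closure D'.carrier)) := by
    intro a b a' b' s s' ν ν' hab hab' hs hs' hν hν' hlim hlim'
    refine hW D a b hab s ν ν' hs hν hν' (hM D.carrier a b s ν hν hlim).2 ?_ ?_ D' hsub h0 h1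
    · -- the carrier of `ν'`, from (S)
      filter_upwards [hS D a' b' hab' s' ν' hs' hν' hlim'] with γ hγ
      exact ⟨hγ.2.2.2.1, hγ.2.2.2.2⟩
    · -- cocycle limits along `s`, bounded by `ν'` on every hull super-domain
      intro E hEsub hE0 hE1 hEε
      obtain ⟨c, hc⟩ := hC D E a b hab hEsub hE0 hE1 hEε
      obtain ⟨c', hc'⟩ := hC D E a' b' hab' hEsub hE0 hE1 hEε
      have hcc' : c = c' :=
        hI D (fun δ x y => ((SAW.law D.carrier δ x y).map (fun γ => γ.curve))
            (CurveClass.rangeSubset (closure E.carrier)))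
          (fun a'' b'' hab'' => hC D E a'' b'' hab'' hEsub hE0 hE1 hEε) a b a' b' c c' hab hab' hc hc'
      refine ⟨c, hc.comp hs, ?_⟩
      have hle := (hM D.carrier a' b' s' ν' hν' hlim').1
        (CurveClass.rangeSubset (closure E.carrier))
        (CurveClass.isClosed_rangeSubset isClosed_closure)
      have hT' : Tendsto (fun n => ((SAW.law D.carrier (s' n) (a' (s' n)) (b' (s' n))).map
          (fun γ => γ.curve)) (CurveClass.rangeSubset (closure E.carrier))) atTop (𝓝 c') :=
        hc'.comp hs'
      rw [hT'.limsup_eq] at hle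
      rwa [hcc']
  exact le_antisymm (key hab hab' hs hs' hν hν' hlim hlim') (key hab' hab hs' hs hν' hν hlim' hlim)

/-! ## The composition: the crux BY NAME from the six stubs -/

/-- **A scaling-limit family from (T), (S), (C), (I), (P), (W)** (the body of `LimitExists`, stated through
`SAW.IsScalingLimitFamily` — `Iff.rfl`-equal — so that the skeleton check sees exactly ONE theorem concluding
the crux by name, `LimitExists_of` below).  For each Dobrushin domain `D` pick an endpoint
approximation (`SAW.exists_isEndpointApprox`), the mesh sequence `1/(n+1)` and, by (T) +
`exists_subseqLimit`, a probability subsequential limit `P D`.  It is chordal (tree: `ae_endpoints_of_hyps`,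
`ae_range_subset_closure_of_hyps`).  Every probability subsequential limit `ν` of `D` along ANY
approximation and sequence equals `P D`: both are carried by simple boundary-avoiding chords by (S) and
have the same hull-subdomain avoidance masses by `avoidanceAgreement_of_stubs`, so
`AvoidanceDeterminesLaw_holds` applies.  Then `Filter.tendsto_of_subseq_tendsto` along the countably
generated filter `𝓝[>] 0` gives `TendstoLaw`. [cite: BillingsleyCPM1999, Thm. 2.6 and Thm. 5.1 Corollary] -/
theorem exists_isScalingLimitFamily_of (hT : Registered.stub_eventualTight)
    (hS : Registered.stub_simpleSubseqLimits) (hC : Registered.stub_avoidanceCocycleLimit)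
    (hI : Registered.stub_interleave) (hM : Registered.stub_portmanteau)
    (hW : Registered.stub_avoidanceSandwich) :
    ∃ P : ChordalFamily, SAW.IsScalingLimitFamily P := by
  classical
  have hA := avoidanceAgreement_of_stubs hS hC hI hM hW
  -- the reference mesh sequence `1/(n+1) → 0⁺`
  have hs₁ : Tendsto (fun n : ℕ => 1 / ((n : ℝ) + 1)) atTop (𝓝[>] (0 : ℝ)) :=
    tendsto_nhdsWithin_iff.2 ⟨tendsto_one_div_add_atTop_nhds_zero_nat,
      Filter.Eventually.of_forall fun n => Set.mem_Ioi.2 Nat.one_div_pos_of_nat⟩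
  -- per domain: a reference approximation, sequence and probability subsequential limit
  have key : ∀ D : DobrushinDomain, ∃ (a b : ℝ → Site 2) (s : ℕ → ℝ) (ν : Measure (CurveClass ℂ)),
      SAW.IsEndpointApprox D a b ∧ Tendsto s atTop (𝓝[>] (0 : ℝ)) ∧ IsProbabilityMeasure ν ∧
      ∀ f : CurveClass ℂ →ᵇ ℝ, Tendsto (fun n => ∫ γ, f γ.curve
        ∂(SAW.law D.carrier (s n) (a (s n)) (b (s n)))) atTop (𝓝 (∫ x, f x ∂ν)) := by
    intro D
    obtain ⟨a, b, hab⟩ := SAW.exists_isEndpointApprox D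
    obtain ⟨δ₀, hδ₀, htight⟩ := hT D a b hab
    obtain ⟨φ, ν, hφ, hν, hlim⟩ := exists_subseqLimit hab hδ₀ htight hs₁
    exact ⟨a, b, fun n => 1 / (((φ n : ℕ) : ℝ) + 1), ν, hab, hs₁.comp hφ.tendsto_atTop, hν, hlim⟩
  choose a₀ b₀ s₀ P hab₀ hs₀ hP hlim₀ using key
  -- uniqueness of subsequential limits: (S), (S), (A) feed `AvoidanceDeterminesLaw_holds`
  have huniq : ∀ (D : DobrushinDomain) (a b : ℝ → Site 2), SAW.IsEndpointApprox D a b →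
      ∀ (s : ℕ → ℝ) (ν : Measure (CurveClass ℂ)), Tendsto s atTop (𝓝[>] (0 : ℝ)) →
      IsProbabilityMeasure ν →
      (∀ f : CurveClass ℂ →ᵇ ℝ, Tendsto (fun n => ∫ γ, f γ.curve
        ∂(SAW.law D.carrier (s n) (a (s n)) (b (s n)))) atTop (𝓝 (∫ x, f x ∂ν))) → ν = P D := by
    intro D a b hab s ν hs hν hlim
    exact AvoidanceDeterminesLaw_holds D ν (P D) hν (hP D) (hS D a b hab s ν hs hν hlim)
      (hS D (a₀ D) (b₀ D) (hab₀ D) (s₀ D) (P D) (hs₀ D) (hP D) (hlim₀ D))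
      (fun D' hsub h0 h1 hε => hA D a b (a₀ D) (b₀ D) hab (hab₀ D) s (s₀ D) ν (P D) hs (hs₀ D)
        hν (hP D) hlim (hlim₀ D) D' hsub h0 h1 hε)
  refine ⟨P, fun D => ⟨hP D, ?_⟩, fun D a b hab f => ?_⟩
  · -- chordal: endpoints and confinement of the reference subsequential limit (tree lemmas)
    haveI := hP D
    filter_upwards [ae_endpoints_of_hyps (hab₀ D) (hs₀ D) (hlim₀ D),
      ae_range_subset_closure_of_hyps (hab₀ D) (hs₀ D) (hlim₀ D)] with γ h1 h2
    exact ⟨h1.1, h1.2, h2⟩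
  · -- convergence along the full filter `𝓝[>] 0`: the subsequence principle
    refine tendsto_of_subseq_tendsto fun ns hns => ?_
    obtain ⟨δ₀, hδ₀, htight⟩ := hT D a b hab
    obtain ⟨φ, ν, hφ, hν, hlim⟩ := exists_subseqLimit hab hδ₀ htight hns
    have hν' : ν = P D :=
      huniq D a b hab (fun n => ns (φ n)) ν (hns.comp hφ.tendsto_atTop) hν hlim
    refine ⟨φ, ?_⟩
    have h := hlim f
    rw [hν'] at h
    simpa only [id_eq] using h

/-- **The composition: `LimitExists` BY NAME from the three open registered stubs (T), (S), (C)** — the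
glue (I), (P), (W) is discharged by the landed tree theorems (`stub_interleave`, `stub_portmanteau`,
`stub_avoidanceSandwich` above, now sorry-free).  [cite: BillingsleyCPM1999, Thm. 2.6] -/
theorem LimitExists_of (hT : Registered.stub_eventualTight) (hS : Registered.stub_simpleSubseqLimits)
    (hC : Registered.stub_avoidanceCocycleLimit) :
    Summit.CriticalPhenomena.SAWScalingLimit.Theses.SAWRestrictionRigidity.LimitExists :=
  exists_isScalingLimitFamily_of hT hS hC stub_interleave stub_portmanteau stub_avoidanceSandwich

/-- Wiring check: the crux BY NAME from the three registered (sorried) stubs — shows the stub theorems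
are exactly the hypotheses of `LimitExists_of` (this declaration inherits their `sorry`, nothing is claimed). -/
theorem LimitExists_wiring :
    Summit.CriticalPhenomena.SAWScalingLimit.Theses.SAWRestrictionRigidity.LimitExists :=
  LimitExists_of stub_eventualTight stub_simpleSubseqLimits stub_avoidanceCocycleLimit

/-! ## Pins (documentation): the three open stubs ARE existing items, by `Iff.rfl` -/

/-- (T) is verbatim this route's support item `EventualTight` (stmt-CriticalPhenomena-1372). -/
theorem stub_eventualTight_iff_item1372 : Registered.stub_eventualTight ↔ EventualTight :=
  Iff.rfl

/-- (S) is verbatim the shared crux `SAWLoopFugacityFlow.SimpleSubseqLimits` (stmt-CriticalPhenomena-4982). -/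
theorem stub_simpleSubseqLimits_iff_item4982 :
    Registered.stub_simpleSubseqLimits ↔
      Summit.CriticalPhenomena.SAWScalingLimit.Theses.SAWLoopFugacityFlow.SimpleSubseqLimits :=
  Iff.rfl

/-- (C) is verbatim this route's r3 crux `AvoidanceCocycleLimit` (stmt-CriticalPhenomena-1369). -/
theorem stub_avoidanceCocycleLimit_iff_item1369 :
    Registered.stub_avoidanceCocycleLimit ↔ AvoidanceCocycleLimit :=
  Iff.rfl

/-- Sanity (necessity of the avoidance agreement): under the crux, every two subsequential limits of the
same domain agree on everything, in particular on avoidance masses — so the statement proved in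
`avoidanceAgreement_of_stubs` is a CONSEQUENCE of `LimitExists` (the glue proves nothing false). -/
theorem avoidanceAgreement_of_limitExists
    (h : Summit.CriticalPhenomena.SAWScalingLimit.Theses.SAWRestrictionRigidity.LimitExists) :
    ∀ (D : DobrushinDomain) (a b a' b' : ℝ → Site 2), SAW.IsEndpointApprox D a b →
      SAW.IsEndpointApprox D a' b' → ∀ (s s' : ℕ → ℝ) (ν ν' : Measure (CurveClass ℂ)),
      Tendsto s atTop (𝓝[>] (0 : ℝ)) → Tendsto s' atTop (𝓝[>] (0 : ℝ)) →
      IsProbabilityMeasure ν → IsProbabilityMeasure ν' →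
      (∀ f : CurveClass ℂ →ᵇ ℝ, Tendsto (fun n => ∫ γ, f γ.curve
        ∂(SAW.law D.carrier (s n) (a (s n)) (b (s n)))) atTop (𝓝 (∫ x, f x ∂ν))) →
      (∀ f : CurveClass ℂ →ᵇ ℝ, Tendsto (fun n => ∫ γ, f γ.curve
        ∂(SAW.law D.carrier (s' n) (a' (s' n)) (b' (s' n)))) atTop (𝓝 (∫ x, f x ∂ν'))) →
      ∀ D' : DobrushinDomain, ν (CurveClass.rangeSubset (closure D'.carrier)) =
        ν' (CurveClass.rangeSubset (closure D'.carrier)) := by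
  obtain ⟨P, hPch, hPlim⟩ := h
  intro D a b a' b' hab hab' s s' ν ν' hs hs' hν hν' hlim hlim' D'
  -- both subsequential limits equal `P D` (weak limits of the same full-filter limit)
  have key : ∀ {a b : ℝ → Site 2} {s : ℕ → ℝ} {ν : Measure (CurveClass ℂ)},
      SAW.IsEndpointApprox D a b → Tendsto s atTop (𝓝[>] (0 : ℝ)) → IsProbabilityMeasure ν →
      (∀ f : CurveClass ℂ →ᵇ ℝ, Tendsto (fun n => ∫ γ, f γ.curve
        ∂(SAW.law D.carrier (s n) (a (s n)) (b (s n)))) atTop (𝓝 (∫ x, f x ∂ν))) → ν = P D := by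
    intro a b s ν hab hs hν hlim
    haveI := (hPch D).1
    haveI := hν
    refine ext_of_forall_integral_eq_of_IsFiniteMeasure fun f => ?_
    have h1 := hlim f
    have h2 : Tendsto (fun n => ∫ γ, f γ.curve ∂(SAW.law D.carrier (s n) (a (s n)) (b (s n))))
        atTop (𝓝 (∫ x, f x ∂(P D))) := by
      have := (hPlim D a b hab f).comp hs
      simpa only [id_eq, Function.comp_def] using this
    exact tendsto_nhds_unique h1 h2
  rw [key hab hs hν hlim, key hab' hs' hν' hlim']

/-! ## Loss analysis of the three open stubs (lead c2; all landed as Theorems, documentation here)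

What does each open stub add to the crux?  (T) nothing; (S) exactly the item `SimpleOfLimit` (stmt-0774);
(C) exactly a null-touching regularity of the limit — and all three are implied by the sub-problem
statement `SAWScalingLimit`, so a `stub-false` on this line is a refutation of the conjunct as typed. -/

/-- (T) is implied by the crux: the reduction loses nothing at the tightness stub
(`eventualTight_of_limitExists`, p148374). [cite: BillingsleyCPM1999, Thm. 5.2] -/
theorem stub_eventualTight_of_crux
    (h : Summit.CriticalPhenomena.SAWScalingLimit.Theses.SAWRestrictionRigidity.LimitExists) :
    Registered.stub_eventualTight :=
  Summit.CriticalPhenomena.SAWScalingLimit.Theorems.SAWRestrictionRigidityLimitExists.eventualTight_of_limitExists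
    h

/-- (S) modulo the crux IS the item `SAWConfRestriction.SimpleOfLimit` (stmt-CriticalPhenomena-0774)
(`simpleSubseqLimits_iff_simpleOfLimit_of_limitExists`, p148840). [cite: BillingsleyCPM1999, Thm. 1.2] -/
theorem stub_simpleSubseqLimits_iff_simpleOfLimit_of_crux
    (h : Summit.CriticalPhenomena.SAWScalingLimit.Theses.SAWRestrictionRigidity.LimitExists) :
    Registered.stub_simpleSubseqLimits ↔
      Summit.CriticalPhenomena.SAWScalingLimit.Theses.SAWConfRestriction.SimpleOfLimit :=
  Summit.CriticalPhenomena.SAWScalingLimit.Theorems.SAWRestrictionRigidityLimitExists.simpleSubseqLimits_iff_simpleOfLimit_of_limitExists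
    h

/-- (C) modulo the crux with witness `P` IS the null-touching regularity of the limit
(`avoidanceCocycleLimit_of_limit_nullTouching`, p148757); under `SAWScalingLimit` it holds outright
(`avoidanceCocycleLimit_of_sawScalingLimit`, `Theorems/SAWRestrictionRigidityLimitExistsCocycleOfScalingLimit`).
[cite: BillingsleyCPM1999, Thm. 2.1] -/
theorem stub_avoidanceCocycleLimit_of_limit_nullTouching
    (h : ∃ P : ChordalFamily, P.IsChordal ∧
      (∀ (D : DobrushinDomain) (a b : ℝ → Site 2), SAW.IsEndpointApprox D a b →
        TendstoLaw (fun δ (γ : SAW.DomainSAW D.carrier δ (a δ) (b δ)) => γ.curve)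
          (fun δ => SAW.law D.carrier δ (a δ) (b δ)) id (P D)) ∧
      (∀ D D' : DobrushinDomain, D'.carrier ⊆ D.carrier → D'.pt 0 = D.pt 0 → D'.pt 1 = D.pt 1 →
        (∃ ε : ℝ, 0 < ε ∧ D'.carrier ∩ ball (D.pt 0) ε = D.carrier ∩ ball (D.pt 0) ε ∧
          D'.carrier ∩ ball (D.pt 1) ε = D.carrier ∩ ball (D.pt 1) ε) →
        P D {γ | γ.range ⊆ closure D'.carrier ∧
          (γ.range ∩ closure (closure D.carrier \ closure D'.carrier)).Nonempty} = 0)) :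
    Registered.stub_avoidanceCocycleLimit :=
  Summit.CriticalPhenomena.SAWScalingLimit.Theorems.SAWRestrictionRigidityLimitExists.avoidanceCocycleLimit_of_limit_nullTouching
    h

/-! (C) — and with it (T) and the crux — is implied by the sub-problem statement:
`avoidanceCocycleLimit_of_sawScalingLimit : SAWScalingLimit → AvoidanceCocycleLimit` and
`inputs_of_sawScalingLimit : SAWScalingLimit → LimitExists ∧ EventualTight ∧ AvoidanceCocycleLimit` (p149105,
`Theorems/SAWRestrictionRigidityLimitExistsCocycleOfScalingLimit.lean`; not imported here to keep this workfile light —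
it pulls in `SAWChargeContinuationSAWAvoidanceLawOfScalingLimit`). -/

/-! ## Barest forms of the crux (lead c3; all landed as Theorems, pinned here by name) -/

/-- POINTWISE form of the crux (p152133): one limit law per (domain, approximation) is enough — the family `P`,
its chordality and its approximation-freeness come for free. [folklore] -/
theorem crux_iff_pointwise :
    Summit.CriticalPhenomena.SAWScalingLimit.Theses.SAWRestrictionRigidity.LimitExists ↔
      ∀ (D : DobrushinDomain) (a b : ℝ → Site 2), SAW.IsEndpointApprox D a b →
        ∃ ν : Measure (CurveClass ℂ), TendstoLaw (fun δ (γ : SAW.DomainSAW D.carrier δ (a δ) (b δ)) => γ.curve)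
          (fun δ => SAW.law D.carrier δ (a δ) (b δ)) id ν :=
  Summit.CriticalPhenomena.SAWScalingLimit.Theorems.SAWRestrictionRigidityLimitExists.limitExists_iff_forall_exists_tendstoLaw

/-- OBSERVABLE-WISE form of the crux, UNCONDITIONAL (p154556): the crux is exactly the convergence of every bounded
continuous observable's critical expectation along `δ → 0⁺`; tightness (T) is automatic by the weak sequential
completeness of `P(CurveClass ℂ)`. [folklore] -/
theorem crux_iff_observablewise :
    Summit.CriticalPhenomena.SAWScalingLimit.Theses.SAWRestrictionRigidity.LimitExists ↔
      ∀ (D : DobrushinDomain) (a b : ℝ → Site 2), SAW.IsEndpointApprox D a b →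
        ∀ f : CurveClass ℂ →ᵇ ℝ, ∃ L : ℝ,
          Tendsto (fun δ => ∫ γ, f γ.curve ∂(SAW.law D.carrier δ (a δ) (b δ))) (𝓝[>] (0 : ℝ)) (𝓝 L) :=
  Summit.CriticalPhenomena.SAWScalingLimit.Theorems.SAWRestrictionRigidityLimitExists.limitExists_iff_forall_tendsto_integral

/-- Observable-wise convergence already gives the tightness stub (T) (p154556). [folklore] -/
theorem stub_eventualTight_of_observablewise
    (hO : ∀ (D : DobrushinDomain) (a b : ℝ → Site 2), SAW.IsEndpointApprox D a b →
      ∀ f : CurveClass ℂ →ᵇ ℝ, ∃ L : ℝ,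
        Tendsto (fun δ => ∫ γ, f γ.curve ∂(SAW.law D.carrier δ (a δ) (b δ))) (𝓝[>] (0 : ℝ)) (𝓝 L)) :
    Registered.stub_eventualTight :=
  Summit.CriticalPhenomena.SAWScalingLimit.Theorems.SAWRestrictionRigidityLimitExists.eventualTight_of_forall_tendsto_integral
    hO

/-! ## Countable form modulo (T), and the leaf census (lead c4; landed p156447, p156523) -/

/-- COUNTABLE form of the crux modulo (T) (p156447): ONE countable separating family `F` of bounded continuous
observables of the curve class with `LimitExists ↔ EventualTight ∧ (∀ D a b approx, ∀ f ∈ F, E_δ[f(curve)] converges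
along δ → 0⁺)`. [folklore] -/
theorem crux_iff_eventualTight_and_countable :
    ∃ F : Set (CurveClass ℂ →ᵇ ℝ), F.Countable ∧
      (∀ μ ν : Measure (CurveClass ℂ), IsFiniteMeasure μ → IsFiniteMeasure ν →
        (∀ f ∈ F, ∫ x, f x ∂μ = ∫ x, f x ∂ν) → μ = ν) ∧
      (Summit.CriticalPhenomena.SAWScalingLimit.Theses.SAWRestrictionRigidity.LimitExists ↔
        (EventualTight ∧ ∀ (D : DobrushinDomain) (a b : ℝ → Site 2), SAW.IsEndpointApprox D a b →
          ∀ f ∈ F, ∃ L : ℝ,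
            Tendsto (fun δ => ∫ γ, f γ.curve ∂(SAW.law D.carrier δ (a δ) (b δ))) (𝓝[>] (0 : ℝ)) (𝓝 L))) :=
  Summit.CriticalPhenomena.SAWScalingLimit.Theorems.SAWRestrictionRigidityLimitExists.limitExists_iff_eventualTight_and_countable

/-- For ANY separating class of observables `F`, modulo (T) the crux is observable-wise convergence on `F`
(p156447). [folklore] -/
theorem crux_iff_eventualTight_and_forall_mem {F : Set (CurveClass ℂ →ᵇ ℝ)}
    (hF : ∀ μ ν : Measure (CurveClass ℂ), IsFiniteMeasure μ → IsFiniteMeasure ν →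
      (∀ f ∈ F, ∫ x, f x ∂μ = ∫ x, f x ∂ν) → μ = ν) :
    Summit.CriticalPhenomena.SAWScalingLimit.Theses.SAWRestrictionRigidity.LimitExists ↔
      (EventualTight ∧ ∀ (D : DobrushinDomain) (a b : ℝ → Site 2), SAW.IsEndpointApprox D a b →
        ∀ f ∈ F, ∃ L : ℝ,
          Tendsto (fun δ => ∫ γ, f γ.curve ∂(SAW.law D.carrier δ (a δ) (b δ))) (𝓝[>] (0 : ℝ)) (𝓝 L)) :=
  Summit.CriticalPhenomena.SAWScalingLimit.Theorems.SAWRestrictionRigidityLimitExists.limitExists_iff_eventualTight_and_forall_mem_tendsto_integral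
    hF

/-- LEAF CENSUS (p156523, `limitExists_of_leaves`, which concludes the crux BY NAME in the tree): the crux from the four
current research leaves of the hub — `VirginArcTraversalTight` (stmt-17940), `ConfinementPositivity` (stmt-17587),
`SequentialSlitAvoidance` (residual of stmt-4982) and `AvoidanceLimit` (stmt-10649).  Stated here through the
`Iff.rfl`-equal body `∃ P, SAW.IsScalingLimitFamily P` so that the skeleton check sees exactly ONE theorem concluding the
crux by name (`LimitExists_of`). [folklore] -/
theorem crux_of_leaves :
    Summit.CriticalPhenomena.SAWScalingLimit.Theses.SAWExcursionCardy.VirginArcTraversalTight →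
      Summit.CriticalPhenomena.SAWScalingLimit.Theses.SAWRenewalTightness.ConfinementPositivity →
      Summit.CriticalPhenomena.SAWScalingLimit.Theorems.SimpleSubseqLimits.SlitRestriction.Transfer.SequentialSlitAvoidance →
      Summit.CriticalPhenomena.SAWScalingLimit.Theses.SAWLoopFugacityFlow.AvoidanceLimit →
      ∃ P : ChordalFamily, SAW.IsScalingLimitFamily P :=
  Summit.CriticalPhenomena.SAWScalingLimit.Theorems.SAWRestrictionRigidityLimitExists.limitExists_of_leaves

/-- Which leaf feeds which registered stub, (T): `VirginArcTraversalTight` ∧ `ConfinementPositivity` ⟹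
`stub_eventualTight` (`EventualTight_of_items`, chain of stmt-1372). [folklore] -/
theorem stub_eventualTight_of_leaves
    (hX : Summit.CriticalPhenomena.SAWScalingLimit.Theses.SAWExcursionCardy.VirginArcTraversalTight)
    (hE : Summit.CriticalPhenomena.SAWScalingLimit.Theses.SAWRenewalTightness.ConfinementPositivity) :
    Registered.stub_eventualTight :=
  Summit.CriticalPhenomena.SAWScalingLimit.Theorems.EventualTight_of_items hX hE

/-- Which leaf feeds which registered stub, (S): `SequentialSlitAvoidance` ∧ `AvoidanceLimit` ⟹
`stub_simpleSubseqLimits` (`line_slitContinuousRestriction`, lead c9 of stmt-4982, p154999). [folklore] -/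
theorem stub_simpleSubseqLimits_of_leaves
    (hσ : Summit.CriticalPhenomena.SAWScalingLimit.Theorems.SimpleSubseqLimits.SlitRestriction.Transfer.SequentialSlitAvoidance)
    (hA : Summit.CriticalPhenomena.SAWScalingLimit.Theses.SAWLoopFugacityFlow.AvoidanceLimit) :
    Registered.stub_simpleSubseqLimits :=
  Summit.CriticalPhenomena.SAWScalingLimit.Theorems.SimpleSubseqLimits.SlitRestriction.Line.line_slitContinuousRestriction
    hσ hA

/-- Which leaf feeds which registered stub, (C): `AvoidanceLimit` ⟹ `stub_avoidanceCocycleLimit`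
(`avoidanceCocycleLimit_of_avoidanceLimit`, p145541). [folklore] -/
theorem stub_avoidanceCocycleLimit_of_leaf
    (hA : Summit.CriticalPhenomena.SAWScalingLimit.Theses.SAWLoopFugacityFlow.AvoidanceLimit) :
    Registered.stub_avoidanceCocycleLimit :=
  Summit.CriticalPhenomena.SAWScalingLimit.Theorems.SAWRestrictionRigidityLimitExists.avoidanceCocycleLimit_of_avoidanceLimit
    hA

/-! ## Bounded leaf census (lead c5; tree twin `limitExists_of_leaves_bounded`, p158457) -/

/-- Which bounded leaf feeds which registered stub, (T): `VirginArcTraversalTightBounded` (stmt-18042) ∧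
`ConfinementPositivity` (stmt-17587) ⟹ `stub_eventualTight` (`EventualTightSWI_of_items`, welding split of the chain of
stmt-1372, over p151500; the route copies of `EventualTight` / `ConfinementPositivity` agree definitionally). [folklore] -/
theorem stub_eventualTight_of_leaves_bounded
    (hX : Summit.CriticalPhenomena.SAWScalingLimit.Theses.SAWWeldingIdentification.VirginArcTraversalTightBounded)
    (hE : Summit.CriticalPhenomena.SAWScalingLimit.Theses.SAWRenewalTightness.ConfinementPositivity) :
    Registered.stub_eventualTight :=
  Summit.CriticalPhenomena.SAWScalingLimit.Theorems.EventualTightSWI_of_items hX hE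

/-- BOUNDED LEAF CENSUS: the crux from the four CURRENT research leaves of the hub — `VirginArcTraversalTightBounded`
(stmt-18042), `ConfinementPositivity` (stmt-17587), `SequentialSlitAvoidance` (residual of stmt-4982) and `AvoidanceLimit`
(stmt-10649) — composed inside this skeleton from the registered composition `LimitExists_of` and the leaf-to-stub
wirings above; stated through the `Iff.rfl`-equal body `∃ P, SAW.IsScalingLimitFamily P` so that the skeleton check sees
exactly ONE theorem concluding the crux by name.  Stronger than `crux_of_leaves` (stmt-17940 ⟹ stmt-18042). [folklore] -/
theorem crux_of_leaves_bounded :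
    Summit.CriticalPhenomena.SAWScalingLimit.Theses.SAWWeldingIdentification.VirginArcTraversalTightBounded →
      Summit.CriticalPhenomena.SAWScalingLimit.Theses.SAWRenewalTightness.ConfinementPositivity →
      Summit.CriticalPhenomena.SAWScalingLimit.Theorems.SimpleSubseqLimits.SlitRestriction.Transfer.SequentialSlitAvoidance →
      Summit.CriticalPhenomena.SAWScalingLimit.Theses.SAWLoopFugacityFlow.AvoidanceLimit →
      ∃ P : ChordalFamily, SAW.IsScalingLimitFamily P :=
  fun hX hE hσ hA => LimitExists_of (stub_eventualTight_of_leaves_bounded hX hE)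
    (stub_simpleSubseqLimits_of_leaves hσ hA) (stub_avoidanceCocycleLimit_of_leaf hA)

/-- The v6 census recovered from the bounded one (`VirginArcTraversalTightBounded_of_item` : stmt-17940 ⟹ stmt-18042).
[folklore] -/
theorem crux_of_leaves_of_bounded :
    Summit.CriticalPhenomena.SAWScalingLimit.Theses.SAWExcursionCardy.VirginArcTraversalTight →
      Summit.CriticalPhenomena.SAWScalingLimit.Theses.SAWRenewalTightness.ConfinementPositivity →
      Summit.CriticalPhenomena.SAWScalingLimit.Theorems.SimpleSubseqLimits.SlitRestriction.Transfer.SequentialSlitAvoidance →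
      Summit.CriticalPhenomena.SAWScalingLimit.Theses.SAWLoopFugacityFlow.AvoidanceLimit →
      ∃ P : ChordalFamily, SAW.IsScalingLimitFamily P :=
  fun hX => crux_of_leaves_bounded
    (Summit.CriticalPhenomena.SAWScalingLimit.Theorems.VirginArcTraversalTightBounded_of_item hX)

end Summit.CriticalPhenomena.SAWScalingLimit.Cruxes.LimitExists.Birth
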